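import Summits.QuantumFields.BalabanUV.Beta.EriceRemainderEnclosureHistoryAutonomyComparisonAgeCompositionThreeAgesDefectGeomMean
import Mathlib.Analysis.MeanInequalities
import Mathlib.Analysis.SpecialFunctions.Pow.Real

/-!
# EriceRemainderEnclosureHistoryAutonomyComparisonAgeCompositionThreeAgesDefectTwoTerms — (E88e) route (N), first order, THREE loaded ages: the envelope
# inequality (★h°[gU]) of (E88a) needs BOTH of its mechanisms — the first-row term `A = r·gU₁·T₀` (the young decay across the old window; it carries the
# infrared-QUIET regime) and the defect sum `B ≥ (1 − r·gU₁)·k₃·GM` (the geometric mean of the rows; it carries the infrared-ACTIVE corner): «`L ≤ A + B`»,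
# and the GIBBS step that turns the logarithm of a sum of two exponentials of linear budgets into a one-parameter family of LINEAR budgets

Cell `pub-balaban`, β-function sub-cell, BINDER row D4 «RemainderConst leaves for Bałaban's split» (`HOME/BINDER-OWNERS.md`; owner lineage `b2b-balaban-beta-an4`;
this file by co-owner #2 lineage `b2b-balaban-beta-d4-p2`, generation 79), β-FLOW TEAM duty (1), FREEZE (0) honoured (def-free; imports (E88b) (uses
`card_mul_exp_mean_log_le_sum` BY NAME) and Mathlib's weighted AM–GM `Real.geom_mean_le_arith_mean2_weighted`; nothing restated).

HONEST FRAMING (page 1, verbatim and binding).  *"Discharging BetaPertH makes Bałaban's UV stability UNCONDITIONAL — a real constructive-QFT result; it is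
NOT the continuum limit and NOT the Clay problem."*  THIS FILE DISCHARGES NOTHING OF THE KIND.  Elementary real analysis (AM–GM, bookkeeping) about displayed
letters — hypotheses of a census, not facts; the form, signs, ages and moments of Bałaban's (1.22) limit functional are NOT PRINTED ([I] p. 298; GAPS
G-t4-U2-1∕-2) and NOT asserted.  Row D4 class UNCHANGED (critical-path width 0; instance 0∕1; D4 DISCHARGE NO DATE).  HONEST DEPENDENCY: continuum YM on T⁴ ⇐
BetaPertH ∧ nine spine estimates (0/9 proved); BetaPertH ⇐ (D1) ∧ (D4) ∧ CAP+tail; G-an2-4 gates asym, D1 and NE2/3/4.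

THE POINT (census sense (α); route (N); README `HOME/b2b-balaban-beta-d4-p2/g79/e88/README.md` §3–§4).  Census (kit j337089: 115 000 records — self-consistent
affine flows over 115 load directions × scales `10⁸…10⁻⁴` × floors × `k₂` × pins `0,1,4,k₃∕2,2k₃`, `k₃ = 32…256`, worst truncation): the B-form of (E88b)∕(E88c)
ALONE fails in the infrared-quiet regime (`k₃(1 − r·gU₁) → 0`; log-margin down to `−1.29` at deep quiet pins) where the first-row term holds, and the first-row
term alone fails in the infrared-active corner (`+0.8…+1.8`) where the B-form holds; the SUM, each term linearised as in (E88c), keeps the exact combined margin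
`ln(e^{−ℓ_A}+e^{−ℓ_B}) ≥ 0.32∕0.39∕0.39∕0.35` (k₃ = 32∕64∕128∕256) on every non-flat flow and `≥ 0.20 ×` the activity on the flat ones.  §1 **`env_product_of_two_terms`**:
(★h°[gU]) at `(m,j)` FROM «`L ≤ A + B_GM`», `A = r·gU₁·Pf(m+1,m+k₃)·ALa_j(m+1)`, `B_GM = (1 − r·gU₁)·k₃·exp((1∕k₃)Σ_{l'} log T_{l'})`; §2 **`gibbs_two`**: for `0 ≤ λ ≤ 1`,
`λ·a + (1−λ)·b − (λ·log λ + (1−λ)·log(1−λ)) ≤ log(e^a + e^b)` — so «`L ≤ A + B_GM`» follows from ANY member of the family of LINEAR budgets `log L ≤ λ·log A +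
(1−λ)·log B_GM + H(λ)`: `λ = 1` the A-budget (young decay across the old window), `λ = 0` the B-budget of (E88c), `λ = ½` their mean plus `log 2`; §3
**`env_product_of_gibbs_budget`** (the composition).  NOT CLAIMED: any member along flows (successor); anything nonlinear; anything printed — NOT B12 Thm 2, NOT BetaPertH.

WHAT IS PROVED ([folklore]; 0 `def`, 0 sorry).  §1 **`env_product_of_two_terms`**; §2 **`gibbs_two`**; §3 **`env_product_of_gibbs_budget`**.
-/
noncomputable section
open Finset

namespace Summit.QuantumFields.BalabanUV.Beta.EriceRemainderEnclosureHistoryAutonomyComparisonAgeCompositionThreeAgesDefectTwoTerms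

open Summit.QuantumFields.BalabanUV.Beta.EriceRemainderEnclosureHistoryAutonomyComparisonAgeCompositionThreeAgesDefectGeomMean (card_mul_exp_mean_log_le_sum)

/-! ## §1 (★h°[gU]) from the two terms -/

/-- **(★h°[gU]) AT `(m, j)` FROM «`L ≤ A + B_GM`».**  Letters of (E88a)∕(E88b) (`r = (h_{m+k₃+1}∕h_{m+k₃})³`, `gU₁ = gU_{m+k₃+1}`, `n₀ = m+1+k₃`, rows
`T_{l'} = Pf(m+1+l',m+k₃)·ALa_j(m+1+l')` positive, `0 ≤ r·gU₁ ≤ 1`).  IF `L := r·gU₁·q_{n₀}·Σ_{l<k₂}[m+2+k₃+l ≤ j]·Π gU ≤ r·gU₁·T₀ + (1 − r·gU₁)·k₃·exp((1∕k₃)Σ_{l'<k₃}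
log T_{l'})`, THEN (★h°[gU]) holds at `(m, j)` (AM–GM on the second term; the first is the `l' = 0` row of (★h°[gU])'s right side verbatim). [folklore] -/
theorem env_product_of_two_terms {h gU q : ℕ → ℝ} {Pf ALa : ℕ → ℕ → ℝ} {k₂ k₃ m j : ℕ} (hk3 : 1 ≤ k₃)
    (hw1 : (h (m + k₃ + 1) / h (m + k₃)) ^ 3 * gU (m + k₃ + 1) ≤ 1)
    (hT : ∀ l' ∈ range k₃, 0 < Pf (m + 1 + l') (m + k₃) * ALa j (m + 1 + l'))
    (htwo : (h (m + k₃ + 1) / h (m + k₃)) ^ 3 * gU (m + k₃ + 1) * q (m + 1 + k₃) *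
          (∑ l ∈ range k₂, if m + 2 + k₃ + l ≤ j then ∏ t ∈ Ico (m + 1 + k₃ + 1 + l) (m + 1 + k₃ + k₂ + 1), gU t else 0) ≤
        (h (m + k₃ + 1) / h (m + k₃)) ^ 3 * gU (m + k₃ + 1) * (Pf (m + 1) (m + k₃) * ALa j (m + 1)) +
          (1 - (h (m + k₃ + 1) / h (m + k₃)) ^ 3 * gU (m + k₃ + 1)) *
            ((k₃ : ℝ) * Real.exp ((∑ l' ∈ range k₃, Real.log (Pf (m + 1 + l') (m + k₃) * ALa j (m + 1 + l'))) / k₃))) :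
    (h (m + k₃ + 1) / h (m + k₃)) ^ 3 * gU (m + k₃ + 1) * q (m + 1 + k₃) *
        (∑ l ∈ range k₂, if m + 2 + k₃ + l ≤ j then ∏ t ∈ Ico (m + 1 + k₃ + 1 + l) (m + 1 + k₃ + k₂ + 1), gU t else 0) ≤
      (1 - (h (m + k₃ + 1) / h (m + k₃)) ^ 3 * gU (m + k₃ + 1)) * ∑ l' ∈ range k₃, Pf (m + 1 + l') (m + k₃) * ALa j (m + 1 + l') +
        (h (m + k₃ + 1) / h (m + k₃)) ^ 3 * gU (m + k₃ + 1) * (Pf (m + 1) (m + k₃) * ALa j (m + 1)) := by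
  have h1 := mul_le_mul_of_nonneg_left (card_mul_exp_mean_log_le_sum hk3 (T := fun l' => Pf (m + 1 + l') (m + k₃) * ALa j (m + 1 + l')) hT)
    (by linarith : 0 ≤ 1 - (h (m + k₃ + 1) / h (m + k₃)) ^ 3 * gU (m + k₃ + 1))
  linarith

/-! ## §2 The Gibbs step: the logarithm of a sum of two exponentials above every chord-plus-entropy -/

/-- **GIBBS FOR TWO TERMS**: for `0 ≤ λ ≤ 1` and reals `a, b`: `λ·a + (1−λ)·b − (λ·log λ + (1−λ)·log(1−λ)) ≤ log(e^a + e^b)` — the weighted AM–GM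
`(e^a∕λ)^λ·(e^b∕(1−λ))^{1−λ} ≤ λ·(e^a∕λ) + (1−λ)·(e^b∕(1−λ))` in logarithms (the endpoints `λ ∈ {0,1}` directly; Lean's `log 0 = 0` makes the entropy term vanish
there, as it should). [folklore] -/
theorem gibbs_two {lam a b : ℝ} (h0 : 0 ≤ lam) (h1 : lam ≤ 1) :
    lam * a + (1 - lam) * b - (lam * Real.log lam + (1 - lam) * Real.log (1 - lam)) ≤ Real.log (Real.exp a + Real.exp b) := by
  have hea := Real.exp_pos a; have heb := Real.exp_pos b
  have hsum : 0 < Real.exp a + Real.exp b := by linarith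
  rcases eq_or_lt_of_le h0 with hl0 | hl0
  · -- λ = 0
    subst hl0
    simp only [zero_mul, sub_zero, one_mul, zero_add, Real.log_one, mul_zero, Real.log_zero]
    have := Real.log_le_log heb (by linarith : Real.exp b ≤ Real.exp a + Real.exp b)
    rwa [Real.log_exp] at this
  rcases eq_or_lt_of_le h1 with hl1 | hl1
  · -- λ = 1
    subst hl1
    simp only [one_mul, sub_self, zero_mul, add_zero, Real.log_one, mul_zero, Real.log_zero, sub_zero]
    have := Real.log_le_log hea (by linarith : Real.exp a ≤ Real.exp a + Real.exp b)
    rwa [Real.log_exp] at this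
  -- 0 < λ < 1: weighted AM–GM with p₁ = e^a∕λ, p₂ = e^b∕(1−λ)
  have hl1' : 0 < 1 - lam := by linarith
  have hp1 : 0 < Real.exp a / lam := div_pos hea hl0
  have hp2 : 0 < Real.exp b / (1 - lam) := div_pos heb hl1'
  have hag := Real.geom_mean_le_arith_mean2_weighted h0 hl1'.le hp1.le hp2.le (by ring)
  have e1 : lam * (Real.exp a / lam) + (1 - lam) * (Real.exp b / (1 - lam)) = Real.exp a + Real.exp b := by
    field_simp
  rw [e1] at hag
  have hpos : 0 < (Real.exp a / lam) ^ lam * (Real.exp b / (1 - lam)) ^ (1 - lam) := mul_pos (Real.rpow_pos_of_pos hp1 _) (Real.rpow_pos_of_pos hp2 _)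
  have hlog := Real.log_le_log hpos hag
  rw [Real.log_mul (Real.rpow_pos_of_pos hp1 _).ne' (Real.rpow_pos_of_pos hp2 _).ne', Real.log_rpow hp1, Real.log_rpow hp2,
    Real.log_div hea.ne' hl0.ne', Real.log_div heb.ne' hl1'.ne', Real.log_exp, Real.log_exp] at hlog
  linarith

/-! ## §3 (★h°[gU]) from any member of the Gibbs family of linear budgets -/

/-- **(★h°[gU]) AT `(m, j)` FROM A λ-BUDGET.**  Same letters; `L`, `A`, `B_GM` as in §1, all three POSITIVE.  IF for some `0 ≤ λ ≤ 1`
`log L ≤ λ·log A + (1−λ)·log B_GM − (λ·log λ + (1−λ)·log(1−λ))`, THEN (★h°[gU]) holds at `(m, j)` (§2 then §1).  `λ = 0` is (E88c)'s route ((E88b)), `λ = 1`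
the first-row (young decay) route, `λ = ½` the mean of the two budgets with the bonus `log 2`. [folklore] -/
theorem env_product_of_gibbs_budget {h gU q : ℕ → ℝ} {Pf ALa : ℕ → ℕ → ℝ} {k₂ k₃ m j : ℕ} {lam : ℝ} (hk3 : 1 ≤ k₃)
    (hw1 : (h (m + k₃ + 1) / h (m + k₃)) ^ 3 * gU (m + k₃ + 1) ≤ 1)
    (hT : ∀ l' ∈ range k₃, 0 < Pf (m + 1 + l') (m + k₃) * ALa j (m + 1 + l'))
    (hL : 0 < (h (m + k₃ + 1) / h (m + k₃)) ^ 3 * gU (m + k₃ + 1) * q (m + 1 + k₃) *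
          (∑ l ∈ range k₂, if m + 2 + k₃ + l ≤ j then ∏ t ∈ Ico (m + 1 + k₃ + 1 + l) (m + 1 + k₃ + k₂ + 1), gU t else 0))
    (hA : 0 < (h (m + k₃ + 1) / h (m + k₃)) ^ 3 * gU (m + k₃ + 1) * (Pf (m + 1) (m + k₃) * ALa j (m + 1)))
    (hB : 0 < (1 - (h (m + k₃ + 1) / h (m + k₃)) ^ 3 * gU (m + k₃ + 1)) *
            ((k₃ : ℝ) * Real.exp ((∑ l' ∈ range k₃, Real.log (Pf (m + 1 + l') (m + k₃) * ALa j (m + 1 + l'))) / k₃)))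
    (h0 : 0 ≤ lam) (h1 : lam ≤ 1)
    (hbud : Real.log ((h (m + k₃ + 1) / h (m + k₃)) ^ 3 * gU (m + k₃ + 1) * q (m + 1 + k₃) *
          (∑ l ∈ range k₂, if m + 2 + k₃ + l ≤ j then ∏ t ∈ Ico (m + 1 + k₃ + 1 + l) (m + 1 + k₃ + k₂ + 1), gU t else 0)) ≤
        lam * Real.log ((h (m + k₃ + 1) / h (m + k₃)) ^ 3 * gU (m + k₃ + 1) * (Pf (m + 1) (m + k₃) * ALa j (m + 1))) +
          (1 - lam) * Real.log ((1 - (h (m + k₃ + 1) / h (m + k₃)) ^ 3 * gU (m + k₃ + 1)) *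
            ((k₃ : ℝ) * Real.exp ((∑ l' ∈ range k₃, Real.log (Pf (m + 1 + l') (m + k₃) * ALa j (m + 1 + l'))) / k₃))) -
          (lam * Real.log lam + (1 - lam) * Real.log (1 - lam))) :
    (h (m + k₃ + 1) / h (m + k₃)) ^ 3 * gU (m + k₃ + 1) * q (m + 1 + k₃) *
        (∑ l ∈ range k₂, if m + 2 + k₃ + l ≤ j then ∏ t ∈ Ico (m + 1 + k₃ + 1 + l) (m + 1 + k₃ + k₂ + 1), gU t else 0) ≤
      (1 - (h (m + k₃ + 1) / h (m + k₃)) ^ 3 * gU (m + k₃ + 1)) * ∑ l' ∈ range k₃, Pf (m + 1 + l') (m + k₃) * ALa j (m + 1 + l') +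
        (h (m + k₃ + 1) / h (m + k₃)) ^ 3 * gU (m + k₃ + 1) * (Pf (m + 1) (m + k₃) * ALa j (m + 1)) := by
  set L := (h (m + k₃ + 1) / h (m + k₃)) ^ 3 * gU (m + k₃ + 1) * q (m + 1 + k₃) *
    (∑ l ∈ range k₂, if m + 2 + k₃ + l ≤ j then ∏ t ∈ Ico (m + 1 + k₃ + 1 + l) (m + 1 + k₃ + k₂ + 1), gU t else 0) with hLdef
  set A := (h (m + k₃ + 1) / h (m + k₃)) ^ 3 * gU (m + k₃ + 1) * (Pf (m + 1) (m + k₃) * ALa j (m + 1)) with hAdef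
  set B := (1 - (h (m + k₃ + 1) / h (m + k₃)) ^ 3 * gU (m + k₃ + 1)) *
    ((k₃ : ℝ) * Real.exp ((∑ l' ∈ range k₃, Real.log (Pf (m + 1 + l') (m + k₃) * ALa j (m + 1 + l'))) / k₃)) with hBdef
  have hg := gibbs_two (a := Real.log A) (b := Real.log B) h0 h1
  rw [Real.exp_log hA, Real.exp_log hB] at hg
  have hle : Real.log L ≤ Real.log (A + B) := hbud.trans hg
  have hLAB : L ≤ A + B := (Real.log_le_log_iff hL (by linarith)).mp hle
  exact env_product_of_two_terms hk3 hw1 hT hLAB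

end Summit.QuantumFields.BalabanUV.Beta.EriceRemainderEnclosureHistoryAutonomyComparisonAgeCompositionThreeAgesDefectTwoTerms

end
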